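import Summits.Schanuel.Schanuel.Theorems.RootDecomp1MCLadder01

/-!
# RootDecomp1 — the MATRIX-COEFFICIENT LADDER on piece D · part 02 of 2: an explicit grade-4 member
(cell decomp-schanuel · lens-1 «grading / quantitative ladder» · g22 · route `route-Schanuel-RootDecomp1`,
piece D = `DisjointSaturatedEssentialSchanuel`, stmt-Schanuel-30353; input: the size-4 layer of
`Summit.Schanuel.Schanuel.Theses.MatrixCoefficients.MatrixCoefficient` = stmt-Schanuel-15349, as a hypothesis)

Part 01 (`RootDecomp1MCLadder01`) proved, uniformly in the grade `n`: the matrix-coefficient sieve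
`det_ne_zero_of_mccAt` (MCC at size `n` + no rational isotropic pair ⇒ no `ℚ`-linearly independent
`z ∈ 𝓛ⁿ` on the degree-`n` cone `det (∑ zₖAₖ) = 0`), its exact reach (`isotropicPair_of_ratPoint`,
`ratPoint_of_isotropicPair`: isotropic pair ⟺ non-zero rational point), the forcing lemma on the size axis
and Baker's unconditional floor rung `n = 2`.  This part DECIDES AN EXPLICIT GRADE-4 CELL modulo MCC₄:

* `k3Pencil` — `L(X) = [[X₀, −X₃, X₂, X₁], [−X₁, X₀+X₃, −X₂+X₃, X₁+X₂], [X₂, −X₁, X₀−X₃, X₂+X₃],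
  [X₃, X₂, −X₁, X₀+X₃]]`, a signed integer lift of the regular representation of `𝔽₁₆ = 𝔽₂[θ]/(θ⁴+θ+1)`
  (`Aₖ ≡ M_{θᵏ} (mod 2)`); `F = det L = mcQuartic` (19 terms, `det_k3Pencil`), and
  `F ≡ Norm_{𝔽₁₆/𝔽₂} (mod 2)` is ANISOTROPIC mod 2 (`mcQuartic_zmod_two`, `decide`), so by 2-adic descent
  (`int_descent`, `rat_descent`) the cone `F = 0` has no non-zero rational point (`k3Cone_no_ratPoint`), hence
  the tensor has no rational isotropic pair (`no_isotropic_pair_k3Pencil`, exact reach), and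
  `k3Cone_free_of_mccFour`: MCC AT SIZE 4 ALONE implies that no `ℚ`-linearly independent quadruple of
  logarithms of algebraic numbers lies on `F = 0` — piece D and Schanuel's inequality hold on this cell
  vacuously (`schanuel_ineq_on_k3Cone_of_mcc`); `k3Cone_free_of_schanuel` is the S-side pin
  (`F(1,0,0,0) = 1`, tree `algIndepLogarithms_of_schanuel`), so the decided statement is on-path.
* PAPER-LEVEL placement (certified outside Lean; lens folder g22/compute/k3pencil-certificate.json): the
  Jacobian ideal of `F` has the complete-intersection Hilbert function `16, 19, 16, 10, 4, 1, 0` in degrees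
  `3…9` (exact ranks modulo two primes), so `V(F) ⊂ ℙ³` is a SMOOTH quartic surface — a K3 surface, not
  uniruled, a fortiori not unirational: the cell lies in D's genuine residue, outside the scope of
  `RationalImageSchanuel` (stmt-29644), one storey (`n = 4`) above g21's pointless elliptic cones; the
  unsigned lift (the norm form of `ℚ(θ)`) would be four planes, decided by Baker — the signs are what make the
  member irreducible and smooth.  `V(F)(ℝ) ≠ ∅`, `V(F)(ℚ₂) = ∅`.

Honest label: a DECISION of an explicit cell of D's Cell(3,0) residue MODULO ONE registered open statement
below `S` (MCC₄ ⊂ stmt-15349), not an unconditional theorem about logarithms; unconditional content = the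
arithmetic of the pencil (determinant, anisotropy, descent, no isotropic pair).  MCC and `Schanuel` occur
only as hypotheses; no `Prop` definitions, no instances, no notation, no axioms.
-/

namespace Summit.Schanuel.Schanuel.Theorems.RootDecomp1MCLadder

open Literature.Barriers.Schanuel
open Summit.Schanuel.Schanuel.Theses.MatrixCoefficients (MatrixCoefficient)

/-! ## §6 An explicit grade-4 member: a pointless `ℚ`-determinantal quartic K3 cone -/

/-- The quartic `F = det L(X)` of `k3Pencil` (over any commutative ring; 19 terms). -/
def mcQuartic {R : Type*} [CommRing R] (a b c d : R) : R :=
  a ^ 4 + a ^ 3 * d - a ^ 2 * b * c - 2 * a ^ 2 * c ^ 2 - a ^ 2 * d ^ 2 + a * b ^ 3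
    + a * b * c * d + a * b * d ^ 2 - a * c ^ 3 + a * c ^ 2 * d - a * d ^ 3 + b ^ 4
    + b ^ 2 * c * d - 2 * b ^ 2 * d ^ 2 + 3 * b * c ^ 3 + 3 * b * d ^ 3 + c ^ 4 + c * d ^ 3 + d ^ 4

/-- The pencil `A = (A₀, A₁, A₂, A₃)`, `Aₖ ∈ M₄(ℤ)`: a signed lift of the regular representation of
`𝔽₁₆ = 𝔽₂[θ]/(θ⁴ + θ + 1)` in the basis `1, θ, θ², θ³` (`Aₖ ≡ M_{θᵏ} (mod 2)`), with signs chosen so that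
`det L` is a SMOOTH quartic (the unsigned lift — the norm form of `ℚ[θ]/(θ⁴+θ+1)` — is four planes). -/
def k3Pencil : Fin 4 → Matrix (Fin 4) (Fin 4) ℚ :=
  ![!![1, 0, 0, 0; 0, 1, 0, 0; 0, 0, 1, 0; 0, 0, 0, 1],
    !![0, 0, 0, 1; -1, 0, 0, 1; 0, -1, 0, 0; 0, 0, -1, 0],
    !![0, 0, 1, 0; 0, 0, -1, 1; 1, 0, 0, 1; 0, 1, 0, 0],
    !![0, -1, 0, 0; 0, 1, 1, 0; 0, 0, -1, 1; 1, 0, 0, 1]]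

/-- The member of the pencil at `z ∈ ℂ⁴`, entrywise:
`L(z) = [[z₀, −z₃, z₂, z₁], [−z₁, z₀+z₃, −z₂+z₃, z₁+z₂], [z₂, −z₁, z₀−z₃, z₂+z₃], [z₃, z₂, −z₁, z₀+z₃]]`. -/
theorem sum_smul_k3Pencil_eq (z : Fin 4 → ℂ) :
    ∑ k, z k • (k3Pencil k).map (algebraMap ℚ ℂ) =
      !![z 0, -z 3, z 2, z 1; -z 1, z 0 + z 3, -z 2 + z 3, z 1 + z 2;
         z 2, -z 1, z 0 - z 3, z 2 + z 3; z 3, z 2, -z 1, z 0 + z 3] := by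
  ext i j
  fin_cases i <;> fin_cases j <;>
    (simp [k3Pencil, Fin.sum_univ_four, Matrix.sum_apply]; try ring)

/-- `det L(z) = F(z)` (Laplace expansion, checked by `ring`). -/
theorem det_k3Pencil (z : Fin 4 → ℂ) :
    (∑ k, z k • (k3Pencil k).map (algebraMap ℚ ℂ)).det = mcQuartic (z 0) (z 1) (z 2) (z 3) := by
  rw [sum_smul_k3Pencil_eq]
  simp [Matrix.det_succ_row_zero, Fin.sum_univ_succ, Fin.succAbove, mcQuartic]
  ring

/-- The rational pencil itself, entrywise (rational points of the cone live here). -/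
theorem sum_smul_k3Pencil_eq_rat (x : Fin 4 → ℚ) :
    ∑ k, x k • k3Pencil k =
      !![x 0, -x 3, x 2, x 1; -x 1, x 0 + x 3, -x 2 + x 3, x 1 + x 2;
         x 2, -x 1, x 0 - x 3, x 2 + x 3; x 3, x 2, -x 1, x 0 + x 3] := by
  ext i j
  fin_cases i <;> fin_cases j <;>
    (simp [k3Pencil, Fin.sum_univ_four, Matrix.sum_apply]; try ring)

/-- `det (∑ xₖ Aₖ) = F(x)` over `ℚ`. -/
theorem det_k3Pencil_rat (x : Fin 4 → ℚ) :
    (∑ k, x k • k3Pencil k).det = mcQuartic (x 0) (x 1) (x 2) (x 3) := by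
  rw [sum_smul_k3Pencil_eq_rat]
  simp [Matrix.det_succ_row_zero, Fin.sum_univ_succ, Fin.succAbove, mcQuartic]
  ring

/-- **Anisotropy mod 2.**  `F ≡ Norm_{𝔽₁₆/𝔽₂} (mod 2)` has no non-trivial zero over `𝔽₂` (sixteen cases,
`decide`). [folklore] -/
theorem mcQuartic_zmod_two :
    ∀ a b c d : ZMod 2, mcQuartic a b c d = 0 → a = 0 ∧ b = 0 ∧ c = 0 ∧ d = 0 := by
  decide

/-- Reduction of `F` modulo `2`. -/
theorem mcQuartic_intCast (a b c d : ℤ) :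
    ((mcQuartic a b c d : ℤ) : ZMod 2) = mcQuartic (a : ZMod 2) (b : ZMod 2) (c : ZMod 2) (d : ZMod 2) := by
  simp [mcQuartic]

/-- `F` is homogeneous of degree `4`: `F(2a, 2b, 2c, 2d) = 16 F(a, b, c, d)`. -/
theorem mcQuartic_two_mul {R : Type*} [CommRing R] (a b c d : R) :
    mcQuartic (2 * a) (2 * b) (2 * c) (2 * d) = 16 * mcQuartic a b c d := by
  simp only [mcQuartic]
  ring

/-- **2-adic descent.**  `F(a, b, c, d) = 0` over `ℤ` forces `a = b = c = d = 0`: modulo `2` all four are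
even (anisotropy of the norm form of `𝔽₁₆`), and halving returns the same equation. [folklore] -/
theorem int_descent (a b c d : ℤ) (h : mcQuartic a b c d = 0) : a = 0 ∧ b = 0 ∧ c = 0 ∧ d = 0 := by
  generalize hn : a.natAbs + b.natAbs + c.natAbs + d.natAbs = n
  induction n using Nat.strong_induction_on generalizing a b c d with
  | _ n ih =>
  have h2 : mcQuartic (a : ZMod 2) (b : ZMod 2) (c : ZMod 2) (d : ZMod 2) = 0 := by
    rw [← mcQuartic_intCast, h, Int.cast_zero]
  obtain ⟨ha, hb, hc, hd⟩ := mcQuartic_zmod_two _ _ _ _ h2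
  obtain ⟨a', rfl⟩ := (ZMod.intCast_zmod_eq_zero_iff_dvd a 2).1 ha
  obtain ⟨b', rfl⟩ := (ZMod.intCast_zmod_eq_zero_iff_dvd b 2).1 hb
  obtain ⟨c', rfl⟩ := (ZMod.intCast_zmod_eq_zero_iff_dvd c 2).1 hc
  obtain ⟨d', rfl⟩ := (ZMod.intCast_zmod_eq_zero_iff_dvd d 2).1 hd
  simp only [Nat.cast_ofNat] at h hn ⊢
  have h' : mcQuartic a' b' c' d' = 0 := by
    have h16 : (16 : ℤ) * mcQuartic a' b' c' d' = 0 := by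
      rw [← mcQuartic_two_mul]; exact h
    exact (mul_eq_zero.mp h16).resolve_left (by norm_num)
  have e : ∀ x : ℤ, ((2 : ℤ) * x).natAbs = 2 * x.natAbs := fun x => by
    rw [Int.natAbs_mul]; rfl
  rw [e, e, e, e] at hn
  rcases Nat.eq_zero_or_pos (a'.natAbs + b'.natAbs + c'.natAbs + d'.natAbs) with h0 | hpos
  · have ha0 : a' = 0 := Int.natAbs_eq_zero.mp (by omega)
    have hb0 : b' = 0 := Int.natAbs_eq_zero.mp (by omega)
    have hc0 : c' = 0 := Int.natAbs_eq_zero.mp (by omega)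
    have hd0 : d' = 0 := Int.natAbs_eq_zero.mp (by omega)
    subst ha0 hb0 hc0 hd0
    simp
  · obtain ⟨e1, e2, e3, e4⟩ :=
      ih (a'.natAbs + b'.natAbs + c'.natAbs + d'.natAbs) (by omega) a' b' c' d' h' rfl
    subst e1 e2 e3 e4
    simp

/-- Rational version: `F(p, q, r, s) = 0` over `ℚ` forces `p = q = r = s = 0` (clear denominators, then
`int_descent`).  Equivalently: the smooth quartic surface `F = 0` has no rational point. [folklore] -/
theorem rat_descent (p q r s : ℚ) (h : mcQuartic p q r s = 0) : p = 0 ∧ q = 0 ∧ r = 0 ∧ s = 0 := by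
  have hp : (p.num : ℚ) = p * p.den := (Rat.mul_den_eq_num p).symm
  have hq : (q.num : ℚ) = q * q.den := (Rat.mul_den_eq_num q).symm
  have hr : (r.num : ℚ) = r * r.den := (Rat.mul_den_eq_num r).symm
  have hs : (s.num : ℚ) = s * s.den := (Rat.mul_den_eq_num s).symm
  -- common denominator `D = p.den q.den r.den s.den`; the integers `P = p.num q.den r.den s.den`, … are `p D`, …
  set D : ℚ := (p.den : ℚ) * q.den * r.den * s.den with hD
  have hP : ((p.num * (q.den * r.den * s.den) : ℤ) : ℚ) = p * D := by push_cast; rw [hp, hD]; ring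
  have hQ : ((q.num * (p.den * r.den * s.den) : ℤ) : ℚ) = q * D := by push_cast; rw [hq, hD]; ring
  have hR : ((r.num * (p.den * q.den * s.den) : ℤ) : ℚ) = r * D := by push_cast; rw [hr, hD]; ring
  have hS : ((s.num * (p.den * q.den * r.den) : ℤ) : ℚ) = s * D := by push_cast; rw [hs, hD]; ring
  have hint : mcQuartic (p.num * (q.den * r.den * s.den)) (q.num * (p.den * r.den * s.den))
      (r.num * (p.den * q.den * s.den)) (s.num * (p.den * q.den * r.den)) = 0 := by
    have hcast : ((mcQuartic (p.num * (q.den * r.den * s.den)) (q.num * (p.den * r.den * s.den))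
        (r.num * (p.den * q.den * s.den)) (s.num * (p.den * q.den * r.den)) : ℤ) : ℚ) = 0 := by
      have e : ((mcQuartic (p.num * (q.den * r.den * s.den)) (q.num * (p.den * r.den * s.den))
          (r.num * (p.den * q.den * s.den)) (s.num * (p.den * q.den * r.den)) : ℤ) : ℚ) =
          mcQuartic (p * D) (q * D) (r * D) (s * D) := by
        rw [← hP, ← hQ, ← hR, ← hS]; simp [mcQuartic]
      rw [e]
      have : mcQuartic (p * D) (q * D) (r * D) (s * D) = D ^ 4 * mcQuartic p q r s := by
        simp only [mcQuartic]; ring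
      rw [this, h, mul_zero]
    exact_mod_cast hcast
  obtain ⟨ha0, hb0, hc0, hd0⟩ := int_descent _ _ _ _ hint
  have hpd : (p.den : ℤ) ≠ 0 := by exact_mod_cast p.den_nz
  have hqd : (q.den : ℤ) ≠ 0 := by exact_mod_cast q.den_nz
  have hrd : (r.den : ℤ) ≠ 0 := by exact_mod_cast r.den_nz
  have hsd : (s.den : ℤ) ≠ 0 := by exact_mod_cast s.den_nz
  refine ⟨Rat.num_eq_zero.mp ?_, Rat.num_eq_zero.mp ?_, Rat.num_eq_zero.mp ?_, Rat.num_eq_zero.mp ?_⟩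
  · exact (mul_eq_zero.mp ha0).resolve_right (mul_ne_zero (mul_ne_zero hqd hrd) hsd)
  · exact (mul_eq_zero.mp hb0).resolve_right (mul_ne_zero (mul_ne_zero hpd hrd) hsd)
  · exact (mul_eq_zero.mp hc0).resolve_right (mul_ne_zero (mul_ne_zero hpd hqd) hsd)
  · exact (mul_eq_zero.mp hd0).resolve_right (mul_ne_zero (mul_ne_zero hpd hqd) hrd)

/-- The cone `F = 0` has no non-zero rational point. [folklore] -/
theorem k3Cone_no_ratPoint (x : Fin 4 → ℚ) (hx : mcQuartic (x 0) (x 1) (x 2) (x 3) = 0) : x = 0 := by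
  obtain ⟨h0, h1, h2, h3⟩ := rat_descent _ _ _ _ hx
  funext k
  fin_cases k
  · exact h0
  · exact h1
  · exact h2
  · exact h3

/-- **The explicit tensor has no rational isotropic pair** — by exact reach (§3): an isotropic pair would
give a non-zero rational point of the cone. [folklore] -/
theorem no_isotropic_pair_k3Pencil (w v : Fin 4 → ℚ)
    (h : ∀ k, ∑ i, ∑ j, w i * k3Pencil k i j * v j = 0) : w = 0 ∨ v = 0 := by
  by_contra hne
  rw [not_or] at hne
  obtain ⟨x, hx, hdet⟩ := ratPoint_of_isotropicPair k3Pencil w v hne.1 hne.2 h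
  rw [det_k3Pencil_rat] at hdet
  exact hx (k3Cone_no_ratPoint x hdet)

/-- **MCC AT SIZE 4 empties the explicit grade-4 cell.**  Under the Matrix Coefficient Conjecture for
`4 × 4` matrices (the size-4 layer of stmt-Schanuel-15349), no `ℚ`-linearly independent quadruple of
logarithms of algebraic numbers lies on the quartic K3 cone `F = 0`; piece D (stmt-Schanuel-30353) holds on
this cell vacuously. [cite: DasguptaKakde2024, Conjecture 1.2] -/
theorem k3Cone_free_of_mccFour
    (hMC4 : ∀ M : Matrix (Fin 4) (Fin 4) ℂ, (∀ i j, IsAlgebraic ℚ (Complex.exp (M i j))) → M.det = 0 →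
      ∃ w v : Fin 4 → ℚ, w ≠ 0 ∧ v ≠ 0 ∧ ∑ i, ∑ j, (w i : ℂ) * M i j * (v j : ℂ) = 0)
    (z : Fin 4 → ℂ) (hz : LinearIndependent ℚ z) (halg : ∀ k, IsAlgebraic ℚ (Complex.exp (z k))) :
    mcQuartic (z 0) (z 1) (z 2) (z 3) ≠ 0 := by
  rw [← det_k3Pencil]
  exact det_ne_zero_of_mccAt hMC4 k3Pencil no_isotropic_pair_k3Pencil z hz halg

/-- The same from the registered all-sizes item `MatrixCoefficient` (stmt-Schanuel-15349).
[cite: DasguptaKakde2024, Conjecture 1.2] -/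
theorem k3Cone_free_of_mcc (hMC : MatrixCoefficient)
    (z : Fin 4 → ℂ) (hz : LinearIndependent ℚ z) (halg : ∀ k, IsAlgebraic ℚ (Complex.exp (z k))) :
    mcQuartic (z 0) (z 1) (z 2) (z 3) ≠ 0 :=
  k3Cone_free_of_mccFour (hMC 4) z hz halg

/-- Vacuous corollary in the summit's format: under MCC, Schanuel's inequality at `n = 4` holds at every
`ℚ`-linearly independent quadruple of logarithms of algebraic numbers on the K3 cone (there is none).
[cite: DasguptaKakde2024, Conjecture 1.2] -/
theorem schanuel_ineq_on_k3Cone_of_mcc (hMC : MatrixCoefficient)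
    (z : Fin 4 → ℂ) (hz : LinearIndependent ℚ z) (halg : ∀ k, IsAlgebraic ℚ (Complex.exp (z k)))
    (hcone : mcQuartic (z 0) (z 1) (z 2) (z 3) = 0) :
    ((4 : ℕ) : Cardinal) ≤ Algebra.trdeg ℚ
      ↥(IntermediateField.adjoin ℚ (Set.range z ∪ Set.range (Complex.exp ∘ z))) :=
  absurd hcone (k3Cone_free_of_mcc hMC z hz halg)

/-- **S-side pin.**  Schanuel's conjecture empties the same cell (through `AlgIndepLogarithms`, tree
`algIndepLogarithms_of_schanuel`: a `ℚ`-linearly independent quadruple in `𝓛` is algebraically independent,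
and `F` is a non-zero polynomial — `F(1, 0, 0, 0) = 1`).  So the statement decided modulo MCC₄ is a
consequence of the summit (on-path). [cite: Waldschmidt2005, §1 Conjecture 1.1] -/
theorem k3Cone_free_of_schanuel (hS : _root_.Schanuel)
    (z : Fin 4 → ℂ) (hz : LinearIndependent ℚ z) (halg : ∀ k, IsAlgebraic ℚ (Complex.exp (z k))) :
    mcQuartic (z 0) (z 1) (z 2) (z 3) ≠ 0 := by
  intro hF
  have hAI : AlgebraicIndependent ℚ z := algIndepLogarithms_of_schanuel (fun n => hS n) 4 z halg hz
  set P : MvPolynomial (Fin 4) ℚ :=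
    mcQuartic (MvPolynomial.X 0) (MvPolynomial.X 1) (MvPolynomial.X 2) (MvPolynomial.X 3) with hP
  have haeval : MvPolynomial.aeval z P = mcQuartic (z 0) (z 1) (z 2) (z 3) := by
    simp [hP, mcQuartic, map_add, map_sub, map_mul, map_pow]
  have hP0 : P = 0 := algebraicIndependent_iff.mp hAI P (haeval.trans hF)
  have h1000 : MvPolynomial.eval ![(1 : ℚ), 0, 0, 0] P = 1 := by
    simp [hP, mcQuartic]
  rw [hP0, map_zero] at h1000
  norm_num at h1000

end Summit.Schanuel.Schanuel.Theorems.RootDecomp1MCLadder
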